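import Literature.Barriers.NavierStokesRegularity.ParallelShearSlotFamily
import HarnessLib

/-!
# Barrier: the parallel-shear slot — every pointwise identity asserted for all classical
# Navier–Stokes solutions is tested on the exact shear heat flows `u = φ(t, x₁) e₀`, `p ≡ 0`
# (Acheson 1990 §2.3 (2.8)–(2.9); Majda–Bertozzi 2002 §1.2)

Barrier catalogue entry for `NavierStokesRegularity` (D-0021), filed by the D-0090 NS-CLAIMS cell
(salvage seat `ns-claims-salvage-p6`) at the METHOD level; gap seed G2 «the parallel-shear /
Stokes-mode line», pointwise half, of the cell's COUNTERMODEL-INDEX §6 (witness family W4); sibling of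
`GalileanFrameSlot` (frame dependence) and companion of `ExactModeLineDecayLaws` (the amplitude /
eigenvalue audit of homogeneous functionals on the `𝕋³` shear-mode line). Adjudicated rows located by
a member of the shear / Stokes-mode family (locators, not authors):
`Literature.Claims.NS.Chio2026.EnergyTransport_pt` (C55, pressure-free energy transport),
`Literature.Claims.NS.Sghiar2016.Step_heat` (C127, componentwise heat equation),
`Literature.Claims.NS.Dou2026c.Step1_vanishingPoint` (C54, channel flows),
`Literature.Claims.NS.Tarver2016.WaveGivesNSAbs` (C80, standing shear wave), and the shear uses in
C03 / C37.

## What is printed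

* Acheson 1990, §2.3 «Plane parallel shear flow», (2.8)–(2.9): for `u = [u(y,t), 0, 0]` the
  Navier–Stokes equations reduce to `∂u/∂t = −(1/ρ)∂p/∂x + ν ∂²u/∂y²`, `∂p/∂y = ∂p/∂z = 0`; the flow
  «automatically satisfies `∇·u = 0`». [Acheson1990] (Tree: `ParallelShear.isClassicalNSSolutionOn_shear`.)
* Majda–Bertozzi 2002, §1.2: elementary exact solutions (shear flows, their viscous decay).
  [MajdaBertozzi2002]

## What is formalised (everything is a theorem of the tree, standard axioms)

Family file `ParallelShearSlotFamily.lean` (namespace `…NavierStokesRegularity.ShearSlot`): for all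
`ν, c, d, s, t₀` the POLYNOMIAL HEAT PROFILE `φ(t, y) = c + d y + (s/2) y² + ν s (t − t₀)` solves
`φ_t = ν φ_yy` exactly, so `u = φ(t, x₁) e₀`, `p ≡ 0` is an unforced classical solution on every time
set of unique differentiability (`isClassicalNSSolutionOn_heatPolyShear`); at `(t₀, 0)` it realises
`u = c e₀`, `∂ₜu = ν s e₀`, `(u·∇)u = 0`, `Δu = s e₀`, `∇p = 0`, `∇(|u|²/2) = c d e₁`,
`Du = d (e₀ ⊗ e₁*)`, `p = 0`, `∂ₜp = 0` with `c, d, s` free. Hence `ShearSlot.shearSlot` (any relation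
among these nine point values valid for all unforced classical solutions holds at that 3-parameter
family of values) and the shape corollaries `no_componentwise_heat_law`,
`no_pressureless_energy_transport`, `laplacian_term_not_slaved`. This file packages them on `[0,∞)` /
all of space-time as `ParallelShearSlot`; `parallelShearSlot_holds` proves it.

## References

* [Acheson1990] D. J. Acheson, *Elementary Fluid Dynamics*, OUP 1990, §2.3 eqs. (2.8)–(2.9).
* [MajdaBertozzi2002] A. J. Majda, A. L. Bertozzi, *Vorticity and Incompressible Flow*, CUP 2002, §1.2.

WHAT THIS IS NOT: not a claim about NS regularity or blow-up; not a claim about any author beyond the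
typed locator.
-/

noncomputable section

open Set Function InnerProductSpace
open scoped ContDiff Laplacian RealInnerProductSpace

namespace Literature.Barriers.NavierStokesRegularity

open Literature.Analysis.FluidPDE Literature.Analysis.FluidPDE.ParallelShear ShearSlot

/-- **Barrier (Acheson 1990 §2.3 (2.8)–(2.9); Majda–Bertozzi 2002 §1.2): the parallel-shear slot.**
Conjunction of: (i) for all `ν, c, d, s, t₀` the polynomial heat-profile shear flow
`u = (c + d x₁ + (s/2) x₁² + ν s (t − t₀)) e₀`, `p ≡ 0` is an unforced classical solution on all of
space-time and on `[0,∞)`; (ii) THE SHEAR SLOT on `[0,∞)`: a relation among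
`(u, ∂ₜu, (u·∇)u, Δu, ∇p, ∇(|u|²/2), Du, p, ∂ₜp)` holding pointwise for all unforced classical solutions
on `[0,∞)` holds at `(c e₀, ν s e₀, 0, s e₀, 0, c d e₁, d (e₀ ⊗ e₁*), 0, 0)` for all `c, d, s`;
(iii) for `ν ≠ 0`, on `[0,∞)`: no componentwise heat law `∂ₜuᵢ = β ∂ᵢ∂ᵢuᵢ`, no pressure-free energy
transport `∂ₜ(½|u|² + p) + u·∇(½|u|² + p) = −ν|∇u|²`, and no pointwise law slaving `νΔu` to
`(u, (u·∇)u, ∇p, ∇(|u|²/2))`. [cite: Acheson1990, §2.3 eqs. (2.8)–(2.9)]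

BARRIER (structured block, D-0021):
technique_class: componentwise-pointwise-identity componentwise-heat-equation pressure-free-local-energy-transport viscous-term-determined-by-inertial-terms vanishing-point-criterion single-phase-representation pointwise-law-for-all-solutions
blocks: (a) every identity among the point values of `u, ∂ₜu, (u·∇)u, Δu, ∇p, ∇|u|², Du, p, ∂ₜp` asserted for ALL classical solutions that fails at `(c e₀, ν s e₀, 0, s e₀, 0, c d e₁, d (e₀ ⊗ e₁*), 0, 0)` for some reals `c, d, s` — conjunct (ii) [cite: Acheson1990, §2.3 eqs. (2.8)–(2.9)]; adjudicated shapes: «each component solves the heat equation in its own variable, `∂ₜuᵢ = β ∂ᵢ²uᵢ`» (`Literature.Claims.NS.Sghiar2016.Step_heat`; conjunct (iii): on the shear line `∂ₜu₀ = ν s` while `∂₀∂₀u₀ = 0`), «pointwise mechanical-energy transport `∂ₜE + u·∇E = −ν|∇u|²`, `E = ½|u|² + p`» (`Literature.Claims.NS.Chio2026.EnergyTransport_pt`; conjunct (iii): at `(c, d, s) = (1, 0, 1)` it reads `ν = 0` — the true identity carries `ν⟪u, Δu⟫`, which differs from `−ν|∇u|²` by a divergence that only vanishes after integration), any law making the viscous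 term a function of the inertial/pressure terms (conjunct (iii), `laplacian_term_not_slaved`); (b) with `GalileanFrameSlot.slot` (where `∂ₜu = −∇p` is free and `Δu = 0`) the two slots separate the three linear mechanisms: `∂ₜu` is tied neither to the spatial 1-jet (frame slot) nor to `∇p` alone, and `νΔu` is tied to `∂ₜu` only through the full equation [cite: MajdaBertozzi2002, §1.2]; (c) any «criterion» evaluated at extrema / vanishing points of `|u|` that ignores that `∂ₜu = νΔu ≠ 0` there on shear flows (channel / Poiseuille-plus-mode shapes, `Literature.Claims.NS.Dou2026c.Step1_vanishingPoint`) [cite: Acheson1990, §2.3 eqs. (2.8)–(2.9)].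
because: for `u = φ(t, x₁) e₀` the convective term `(u·∇)u = u₁∂₁u = 0` and `div u = ∂₀φ(x₁) = 0` vanish identically, so the Navier–Stokes system is EXACTLY the linear heat equation `φ_t = ν φ_yy` with `p ≡ 0` [cite: Acheson1990, §2.3 eq. (2.9)]; heat polynomials realise every 2-jet `(φ, φ_y, φ_yy) = (c, d, s)` at a point with `φ_t = ν s`, so a pointwise law can only survive if it is an identity on this 3-parameter family — in particular every law in which the viscous term is dropped, mis-scaled, mis-indexed or replaced by a first-order expression dies, with `ν ≠ 0` visible in the failure.
evasions_known: (1) integral (not pointwise) identities: the energy EQUALITY `d/dt ∫½|u|² = −ν∫|∇u|²` is true because the divergence `ν div(u·∇u)`… integrates away — the slot refutes only the pointwise transplant [cite: MajdaBertozzi2002, §1.2]; (2) laws stated with the full material/Stokes operator `∂ₜu + (u·∇)u + ∇p − νΔu` (which vanishes identically) pass trivially and say nothing; (3) the family is planar, unidirectional, pressure-free and has straight vortex lines (`ω = −φ_y e₂`): it tests componentwise / viscous bookkeeping only — no vortex stretching, no pressure–velocity coupling (those need the Beltrami line `BeltramiNonlinearity` / `VortexStretchingAprioriBounds`) [cite: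 MajdaBertozzi2002, §1.2]; (4) restricting a claim to finite-energy data on `ℝ³` does not evade the slot in substance: the same local values are realised by compactly supported shear-like profiles up to exponentially small heat tails, but that localisation is NOT formalised here (scope (b)).
scope_caveats: (a) `ℝ³ = EuclideanSpace ℝ (Fin 3)` with stream direction `e₀` and shear coordinate `x₁`, unforced, any real `ν` for (i)–(ii) and `ν ≠ 0` for (iii); classical pointwise solutions in the tree sense `IsClassicalNSSolutionOn` (one-sided time derivative within the time set); (b) the members have infinite energy (no decay in `x₀, x₂`; polynomial growth in `x₁`), so they are not Clay (A) solutions — like the frame slot, this is a test for laws quantified over ALL classical solutions or derived pointwise from (1)–(3) alone; (c) no walls are modelled (a channel flow is the restriction of a member; no-slip data enter only through the choice of profile); (d) second time derivatives and mixed space derivatives beyond `Du`, `Δu` are not slots here (the wave-equation shape `∂ₜ²u = νΔu` of C80 is refuted in its own kernel file by a standing shear wave).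
status: established; every conjunct proved in the tree (`parallelShearSlot_holds`, standard axioms) -/
def ParallelShearSlot : Prop :=
  (∀ ν c d s t₀ : ℝ,
      IsClassicalNSSolutionOn univ ν 0
          (shearVelocity fun t y => c + d * y + s / 2 * y ^ 2 + ν * s * (t - t₀)) (shearPressure fun _ => 0) ∧
        IsClassicalNSSolutionOn (Ici 0) ν 0
          (shearVelocity fun t y => c + d * y + s / 2 * y ^ 2 + ν * s * (t - t₀)) (shearPressure fun _ => 0)) ∧
  (∀ (ν : ℝ) (R : E3 → E3 → E3 → E3 → E3 → E3 → (E3 →L[ℝ] E3) → ℝ → ℝ → Prop),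
      (∀ (u : ℝ → E3 → E3) (p : ℝ → E3 → ℝ), IsClassicalNSSolutionOn (Ici 0) ν 0 u p →
          ∀ t ∈ Ici (0 : ℝ), ∀ x, R (u t x) (timeDerivWithin (Ici 0) u t x) (convect (u t) (u t) x)
            ((Δ (u t)) x) (gradient (p t) x) (gradient (fun z => ‖u t z‖ ^ 2 / 2) x) (fderiv ℝ (u t) x)
            (p t x) (timeDerivWithin (Ici 0) p t x)) →
        ∀ c d s : ℝ,
          R (c • EuclideanSpace.single (0 : Fin 3) (1 : ℝ)) ((ν * s) • EuclideanSpace.single (0 : Fin 3) (1 : ℝ))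
            0 (s • EuclideanSpace.single (0 : Fin 3) (1 : ℝ)) 0 ((c * d) • EuclideanSpace.single (1 : Fin 3) (1 : ℝ))
            ((EuclideanSpace.proj (1 : Fin 3) : E3 →L[ℝ] ℝ).smulRight (d • EuclideanSpace.single (0 : Fin 3) (1 : ℝ)))
            0 0) ∧
  (∀ ν : ℝ, ν ≠ 0 →
      (¬ ∃ β : ℝ, ∀ (u : ℝ → E3 → E3) (p : ℝ → E3 → ℝ), IsClassicalNSSolutionOn (Ici 0) ν 0 u p →
          ∀ t ∈ Ici (0 : ℝ), ∀ (x : E3) (i : Fin 3),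
            timeDerivWithin (Ici 0) u t x i =
              β * fderiv ℝ (fun z : E3 => fderiv ℝ (u t) z (EuclideanSpace.single i (1 : ℝ)) i) x
                (EuclideanSpace.single i (1 : ℝ))) ∧
      (¬ ∀ (u : ℝ → E3 → E3) (p : ℝ → E3 → ℝ), IsClassicalNSSolutionOn (Ici 0) ν 0 u p →
          ∀ t ∈ Ici (0 : ℝ), ∀ x : E3,
            ⟪u t x, timeDerivWithin (Ici 0) u t x⟫ + timeDerivWithin (Ici 0) p t x +
                ⟪u t x, gradient (fun z => ‖u t z‖ ^ 2 / 2) x + gradient (p t) x⟫ =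
              -ν * ∑ i : Fin 3, ‖fderiv ℝ (u t) x (EuclideanSpace.single i (1 : ℝ))‖ ^ 2) ∧
      (¬ ∃ Ψ : E3 → E3 → E3 → E3 → E3, ∀ (u : ℝ → E3 → E3) (p : ℝ → E3 → ℝ),
          IsClassicalNSSolutionOn (Ici 0) ν 0 u p →
            ∀ t ∈ Ici (0 : ℝ), ∀ x : E3, ν • (Δ (u t)) x =
              Ψ (u t x) (convect (u t) (u t) x) (gradient (p t) x) (gradient (fun z => ‖u t z‖ ^ 2 / 2) x)))

/-- **The barrier holds** (every conjunct is one of the `ShearSlot.*` theorems of the family file, on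
the time sets `univ` / `Ici 0` with `t₀ = 0`). [cite: Acheson1990, §2.3 eqs. (2.8)–(2.9)] -/
theorem parallelShearSlot_holds : ParallelShearSlot := by
  refine ⟨fun ν c d s t₀ => ⟨isClassicalNSSolutionOn_heatPolyShear uniqueDiffOn_univ ν c d s t₀,
      isClassicalNSSolutionOn_heatPolyShear (uniqueDiffOn_Ici 0) ν c d s t₀⟩,
    fun ν R hR c d s => shearSlot (uniqueDiffOn_Ici 0) (t₀ := 0) (by simp) hR c d s,
    fun ν hν => ⟨no_componentwise_heat_law (uniqueDiffOn_Ici 0) (t₀ := 0) (by simp) hν,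
      no_pressureless_energy_transport (uniqueDiffOn_Ici 0) (t₀ := 0) (by simp) hν,
      laplacian_term_not_slaved (uniqueDiffOn_Ici 0) (t₀ := 0) (by simp) hν⟩⟩

/-- Projection (ii): the shear slot on `[0,∞)`. [cite: Acheson1990, §2.3 eqs. (2.8)–(2.9)] -/
theorem ParallelShearSlot.slot_Ici (h : ParallelShearSlot) {ν : ℝ}
    {R : E3 → E3 → E3 → E3 → E3 → E3 → (E3 →L[ℝ] E3) → ℝ → ℝ → Prop}
    (hR : ∀ (u : ℝ → E3 → E3) (p : ℝ → E3 → ℝ), IsClassicalNSSolutionOn (Ici 0) ν 0 u p →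
        ∀ t ∈ Ici (0 : ℝ), ∀ x, R (u t x) (timeDerivWithin (Ici 0) u t x) (convect (u t) (u t) x)
          ((Δ (u t)) x) (gradient (p t) x) (gradient (fun z => ‖u t z‖ ^ 2 / 2) x) (fderiv ℝ (u t) x)
          (p t x) (timeDerivWithin (Ici 0) p t x))
    (c d s : ℝ) :
    R (c • EuclideanSpace.single (0 : Fin 3) (1 : ℝ)) ((ν * s) • EuclideanSpace.single (0 : Fin 3) (1 : ℝ))
      0 (s • EuclideanSpace.single (0 : Fin 3) (1 : ℝ)) 0 ((c * d) • EuclideanSpace.single (1 : Fin 3) (1 : ℝ))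
      ((EuclideanSpace.proj (1 : Fin 3) : E3 →L[ℝ] ℝ).smulRight (d • EuclideanSpace.single (0 : Fin 3) (1 : ℝ)))
      0 0 :=
  h.2.1 ν R hR c d s

/-- Projection (iii, b): no pressure-free pointwise energy transport for `ν ≠ 0`.
[cite: Acheson1990, §2.3 eq. (2.9)] -/
theorem ParallelShearSlot.no_energy_transport (h : ParallelShearSlot) {ν : ℝ} (hν : ν ≠ 0) :
    ¬ ∀ (u : ℝ → E3 → E3) (p : ℝ → E3 → ℝ), IsClassicalNSSolutionOn (Ici 0) ν 0 u p →
        ∀ t ∈ Ici (0 : ℝ), ∀ x : E3,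
          ⟪u t x, timeDerivWithin (Ici 0) u t x⟫ + timeDerivWithin (Ici 0) p t x +
              ⟪u t x, gradient (fun z => ‖u t z‖ ^ 2 / 2) x + gradient (p t) x⟫ =
            -ν * ∑ i : Fin 3, ‖fderiv ℝ (u t) x (EuclideanSpace.single i (1 : ℝ))‖ ^ 2 :=
  ((h.2.2 ν hν).2).1

end Literature.Barriers.NavierStokesRegularity

end
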